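import Mathlib
import Summits.Ventures.HSemireg.ApolarGramSign
import Summits.Ventures.HSemireg.WedgeWeilPurityOneSided

/-!
# Venture HSemireg — the ONE-SIDED RANK LAW in closed form for exponential Hankel data

HONEST FRAMING. Finite-dimensional linear algebra in the cell's wedge model only (th-7/p4/p6's
exterior-algebra model of `HT•` of an abelian `2n`-fold); no variety / sheaf / semiregularity map is
constructed; nothing here says that HC / HC_CM / HC_AV holds; no Literature fact is declared or
assumed.

Sixth and last file of the apolar chain (cell pub-hsemireg; FORMULA-N PART A §2.9 COROLLARY =
PART B §L.11–§L.12, th-7's ONE-SIDED RANK LAW). It DOCKS th-6's apolar Gram chain onto p6's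
compression theorem `Wedge.Weil.weilPurity_oneSided_b_zero`
(`finrank range(∧(f + a·w₊) ∣ ⋀ⁿ) + 2ρ + C(2n,n) = C(2n,n)ρ + 2C(2n,n) + rank(H_n Ω_n H_n)`,
`ρ = rank H`, every field, `a ≠ 0`):

* `hsq_eq_Hsq` / `omega_eq_Omega` — th-6's `hsq`/`omega` ARE p6's `Wedge.Weil.Hsq`/`Omega` at
  `K = ℝ` (`rfl`); `rank_hankel1_eq` — the model's `hankel1 ℝ (n+n) n q` is `hsq n q` up to a cast
  of the column index.
* **`oneSided_rank_law`** — for EXPONENTIAL data `q_k = Σ_{i<ρ} c_i x_i^k` with DISTINCT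
  increasing real atoms, non-zero weights, `1 ≤ ρ ≤ n + 1`, `n ≥ 1`, `a ≠ 0`:
  `finrank range(∧(f + a·w₊) ∣ ⋀ⁿ) + 2ρ + C(2n,n) = C(2n,n)·ρ + 2·C(2n,n) + r(n,ρ)` with
  `r(n,ρ) = ρ − [ρ = 1]` (`n` even), `= 2⌊ρ/2⌋` (`n` odd) — i.e. th-7's closed form
  `R₀ = C(2n,n)(1+ρ) − ρ − [ρ = 1]` (`n` even), `= C(2n,n)(1+ρ) − 2⌈ρ/2⌉` (`n` odd), stated
  additively (no truncated subtraction).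
-/

noncomputable section

open Summit.Ventures.HSemireg.Wedge.Hankel Summit.Ventures.HSemireg.Wedge.Weil

namespace Summit.Ventures.HSemireg.ApolarGram

/-- th-6's `hsq` is p6's `Hsq` at `K = ℝ`. -/
theorem hsq_eq_Hsq (n : ℕ) (q : ℕ → ℝ) : hsq n q = Wedge.Weil.Hsq ℝ n q := rfl

/-- th-6's `omega` is p6's `Omega` at `K = ℝ`. -/
theorem omega_eq_Omega (n : ℕ) : omega n = Wedge.Weil.Omega ℝ n := rfl

/-- the model's `hankel1 ℝ (n+n) n q` is `hsq n q` with the column index cast along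
`n + n + 1 − n = n + 1`. -/
theorem hankel1_eq_submatrix (n : ℕ) (q : ℕ → ℝ) :
    hankel1 ℝ (n + n) n q = (hsq n q).submatrix id (Fin.cast (by omega)) := by
  ext i s
  simp [hankel1, hsq]

/-- hence the same rank. -/
theorem rank_hankel1_eq (n : ℕ) (q : ℕ → ℝ) : (hankel1 ℝ (n + n) n q).rank = (hsq n q).rank := by
  rw [hankel1_eq_submatrix]
  exact Matrix.rank_submatrix (hsq n q) (Equiv.refl _) (finCongr (by omega))

/-- **THE ONE-SIDED RANK LAW IN CLOSED FORM** (exponential data with distinct increasing real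
atoms, non-zero weights, `1 ≤ ρ ≤ n + 1`, `n ≥ 1`, `a ≠ 0`, `b = 0`):
`finrank range(∧(f + a·w₊) ∣ ⋀ⁿ) + 2ρ + C(2n,n) = C(2n,n)·ρ + 2·C(2n,n) + r(n,ρ)`,
`r(n,ρ) = ρ − [ρ = 1]` for `n` even, `2⌊ρ/2⌋` for `n` odd. -/
theorem oneSided_rank_law {n ρ : ℕ} (hn : 1 ≤ n) (hρ : 1 ≤ ρ) (hρn : ρ ≤ n + 1)
    {c x : Fin ρ → ℝ} (hc : ∀ i, c i ≠ 0) (hx : StrictMono x) {a : ℝ} (ha : a ≠ 0) :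
    Module.finrank ℝ (LinearMap.range (wedge ℝ (n + n) n (vW ℝ (n + n) n (expMoments c x) a 0))) +
        2 * ρ + (n + n).choose n =
      (n + n).choose n * ρ + ((n + n).choose n + (n + n).choose n) +
        (if Even n then ρ - (if ρ = 1 then 1 else 0) else 2 * (ρ / 2)) := by
  have h := weilPurity_oneSided_b_zero ℝ hn (expMoments c x) ha
  rw [rank_hankel1_eq, rank_hsq_expMoments hρn hc hx.injective, ← hsq_eq_Hsq, ← omega_eq_Omega,
    rank_hsq_omega_hsq hρn hc hx.injective, apolarGram_rank hn hρ hρn hx] at h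
  exact h

/-- the same with th-7's two closed forms made explicit: `n` even, `ρ ≥ 2`:
`finrank + ρ = C(2n,n)(1+ρ)`; `n` odd: `finrank + 2⌈ρ/2⌉ = C(2n,n)(1+ρ)`. -/
theorem oneSided_rank_law_even {n ρ : ℕ} (hn : Even n) (hn1 : 1 ≤ n) (hρ : 2 ≤ ρ) (hρn : ρ ≤ n + 1)
    {c x : Fin ρ → ℝ} (hc : ∀ i, c i ≠ 0) (hx : StrictMono x) {a : ℝ} (ha : a ≠ 0) :
    Module.finrank ℝ (LinearMap.range (wedge ℝ (n + n) n (vW ℝ (n + n) n (expMoments c x) a 0))) + ρ =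
      (n + n).choose n * (1 + ρ) := by
  have h := oneSided_rank_law hn1 (by omega) hρn hc hx ha
  rw [if_pos hn, if_neg (by omega : ρ ≠ 1)] at h
  have : (n + n).choose n * (1 + ρ) = (n + n).choose n + (n + n).choose n * ρ := by ring
  omega

/-- `n` odd: `finrank + 2⌈ρ/2⌉ = C(2n,n)(1+ρ)` (`1 ≤ ρ ≤ n + 1`). -/
theorem oneSided_rank_law_odd {n ρ : ℕ} (hn : Odd n) (hρ : 1 ≤ ρ) (hρn : ρ ≤ n + 1)
    {c x : Fin ρ → ℝ} (hc : ∀ i, c i ≠ 0) (hx : StrictMono x) {a : ℝ} (ha : a ≠ 0) :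
    Module.finrank ℝ (LinearMap.range (wedge ℝ (n + n) n (vW ℝ (n + n) n (expMoments c x) a 0))) +
        2 * ((ρ + 1) / 2) = (n + n).choose n * (1 + ρ) := by
  have h := oneSided_rank_law (by rcases hn with ⟨k, hk⟩; omega) hρ hρn hc hx ha
  rw [if_neg (Nat.not_even_iff_odd.2 hn)] at h
  have : (n + n).choose n * (1 + ρ) = (n + n).choose n + (n + n).choose n * ρ := by ring
  omega

end Summit.Ventures.HSemireg.ApolarGram
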